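import Literature.Geometry.Kaehler.ComplexTorusSimpleCMSurfaceEigenframe
import Literature.Geometry.Kaehler.ComplexTorusAbelianThreefoldStablyNondegenerate
import Literature.Geometry.Kaehler.ComplexTorusSimpleAbelianThreefoldFourCases
import HarnessLib

/-!
# The eigenframe of a simple complex abelian threefold with complex multiplication: `Hg(T)(ℂ) = P 𝕋_π P⁻¹`,
# `Lie Hg(T)(ℂ) = {P diag(z) P⁻¹ | z ∘ π = -z}`, `J = P diag(i s) P⁻¹`, `Aut(ℂ)` permutes the six eigenlines, TRANSITIVELY
# (Moonen–Zarhin 1999 §2 (2.3) Type IV(3,1): `Hg(X) = U_F`, `F` a sextic CM field; the companion of g53-#2 for surfaces)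

Layer `Literature/Geometry/Kaehler`, namespace `Literature.Geometry.Kaehler.ComplexTorus`; lane `lit-hodgefound` (Track 2
foundations library), Layer A3∕A4; prover seat `lit-hodgefound-p17` (generation 55, self-proposed row g55-#11).  THEOREMS ONLY (no
definition, no instance, no notation, no named fact; D-0026 net debt 0).  The consumer is g55-#12
(`ComplexTorusSimpleCMThreefoldTimesCMSurfaceHodgeGroup`: Moonen–Zarhin (5.10) with `d_min = 2` and both factors of CM type,
`Hg(T × S) = Hg(T) × Hg(S)`), which feeds the data below, together with g53-#2's eigenframe of the CM surface, into the pure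
linear algebra of g55-#10 (`Literature/LinearAlgebra/CMThreefoldSurfaceCocharacterSplitting`).

DICTIONARY.  `T = E ∕ Ψ(ℤ^κ)` a simple polarised complex abelian threefold (`IsSimple Ψ`, `IsRiemannForm Ψ η`, `dim_ℂ E = 3`, so
`#κ = 6`) whose endomorphism algebra `End⁰(T) = F` has `[F : ℚ] = 6` (Type IV(3,1): `F` a sextic CM field, `T` of CM type,
`Hg(T) = U_F`, Moonen–Zarhin (2.3); the tree's `IsSimple.four_cases_of_finrank_eq_three`).  `P ∈ GL₆(ℂ)` is a common eigenbasis of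
`End⁰(T) ⊗ ℂ` (columns = the six eigenlines `V_j`, `j ∈ κ`), `π` the fixed-point-free involution of `κ` pairing `V_j` with the
only line not `E`-orthogonal to it, `𝕋_π = {diag(d) | d_{π j} d_j = 1}` (the tree's `pairedDiagTorus`;
`ComplexTorusCMLefschetzGroupConnected`: `S(T)(ℂ) = P 𝕋_π P⁻¹`; `Hg(T)(ℂ) = S(T)(ℂ)` for every polarised threefold, the tree's
`IsRiemannForm.hodgeGroupC_eq_lefschetzGroupC_of_finrank_eq_three`).  The character of the line `j` is `χ_j : F → ℂ`,
`A ⊗ 1 = P diag(χ_•(A)) P⁻¹`; the six `χ_j` are pairwise distinct, so — `F` being a field — `Aut(ℂ)` permutes them TRANSITIVELY.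

## Sources, verbatim

* B. Moonen, Yu. G. Zarhin [MoonenZarhin1999LowDim], held `paper:arxiv-math_9901113`: §2 (2.3) `g = 3` (p0005 L104–L106) «Type
  IV(3,1): `End⁰(X) = F` is a sextic CM field; `X` is of CM-type. We have `Hg(X) = U_F`, and `X` satisfies condition (D)»;
  §5 (5.10) (p0010 L24–L45: «If `Y₂` is of CM-type then `F₂ = End⁰(Y₂)` is a sextic CM-field … `k·Ω₂` contains the splitting
  field of `U_{F₂}`»); §1 (p0002 L124–L131: the torus `U_F`, `X*(U_F)` with its Galois action).
* G. Shimura [Shimura1998], *Abelian Varieties with Complex Multiplication and Modular Functions*, §5.1 Lemma 2, Prop. 5–6, §8.4.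
* A. Borel [Borel1991], *Linear Algebraic Groups*, §8.11 (the `Γ`-action on `X*(T)` of an `F`-torus), AG §14.
* T. A. Springer [Springer1998], *Linear Algebraic Groups*, 2nd ed., 3.2.10 (4), 4.4.13, 13.1.1.

## What is proved

* §0 plumbing (private, copied from g53-#2 where they are file-local): `σ`-stability of the complex span of rational matrices,
  algebra in a fixed frame `P`.
* §1 **`IsSimple.exists_cmEigenframe_of_finrank_centerField_eq_six_of_finrank_eq_three`** — THE EIGENFRAME of a simple CM
  threefold: `π`, `P`, a sign vector `s`, with (a) `Hg(T)(ℂ) = P 𝕋_π P⁻¹`, (b) `P diag(z) P⁻¹ ∈ Lie Hg(T)(ℂ) ⟺ z ∘ π = -z`, (c) every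
  element of `Lie Hg(T)(ℂ)` is a `P diag(z) P⁻¹`, (d) `s = ±1`, `s ∘ π = -s`, `J ⊗ 1 = P diag(i s) P⁻¹`, (e) every `σ ∈ Aut(ℂ)` acts
  by a line permutation commuting with `π`, (f') TRANSITIVITY: for all lines `j, j'` some `σ ∈ Aut(ℂ)` acts by a permutation
  carrying `j` to `j'`, (g) `#κ = 6`.  The proof follows g53-#2 verbatim for (a)–(e) (with the threefold inputs `Hg(T)(ℂ) = S(T)(ℂ)`
  and `[End⁰(T) : ℚ] = 6 = #κ`); (f') is `exists_ringEquiv_apply_eq` on the distinct characters `χ_j`, `χ_{j'}`.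
-/

noncomputable section

open Matrix Module Function Cardinal
open scoped MatrixGroups ComplexConjugate

namespace Literature.Geometry.Kaehler

namespace ComplexTorus

open Literature.NumberTheory.Automorphic (IsZConnected IsAlgebraicSubgroup lieAlgebraGL exp_smul_diagonal
  exists_mem_coe_eq_exp_smul_of_mem_lieAlgebraGL mem_lieAlgebraGL_of_forall_exp_smul_mem)
open Literature.FieldTheory.AlgClosed (exists_ringEquiv_apply_eq)

/-! ### §0 Plumbing (file-local; as in g53-#2) -/

section Plumbing

variable {ι : Type*} [Fintype ι] [DecidableEq ι]

omit [Fintype ι] [DecidableEq ι] in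
/-- `σ` fixes rational matrices: `σ(A ⊗ 1) = A ⊗ 1`. [folklore] -/
private theorem map_algebraMap_map_ringEquiv₅₅ (σ : ℂ ≃+* ℂ) (A : Matrix ι ι ℚ) :
    (A.map (algebraMap ℚ ℂ)).map σ = A.map (algebraMap ℚ ℂ) := by
  ext i j
  simp [Matrix.map_apply]

omit [Fintype ι] [DecidableEq ι] in
/-- The complex span of a set of rational matrices is stable under the entrywise action of `Aut(ℂ)`. [folklore] -/
private theorem map_ringEquiv_mem_span₅₅ (σ : ℂ ≃+* ℂ) (R : Set (Matrix ι ι ℚ)) {Z : Matrix ι ι ℂ}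
    (hZ : Z ∈ Submodule.span ℂ ((fun A : Matrix ι ι ℚ ↦ A.map (algebraMap ℚ ℂ)) '' R)) :
    Z.map σ ∈ Submodule.span ℂ ((fun A : Matrix ι ι ℚ ↦ A.map (algebraMap ℚ ℂ)) '' R) := by
  induction hZ using Submodule.span_induction with
  | mem Y hY =>
    obtain ⟨A, hA, rfl⟩ := hY
    rw [map_algebraMap_map_ringEquiv₅₅]
    exact Submodule.subset_span ⟨A, hA, rfl⟩
  | zero =>
    rw [Matrix.map_zero _ (map_zero σ)]
    exact zero_mem _
  | add Y Y' _ _ hY hY' =>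
    rw [Matrix.map_add _ (map_add σ)]
    exact add_mem hY hY'
  | smul c Y _ hY =>
    have h : (c • Y).map (σ : ℂ → ℂ) = σ c • Y.map σ := by
      ext i j
      simp [Matrix.map_apply]
    rw [h]
    exact Submodule.smul_mem _ _ hY


variable {P : Matrix ι ι ℂ}

/-- `P⁻¹ (P X P⁻¹) P = X`. [folklore] -/
private theorem inv_mul_conj_mul₅₅ (hP : IsUnit P.det) (X : Matrix ι ι ℂ) : P⁻¹ * (P * X * P⁻¹) * P = X := by
  rw [show P⁻¹ * (P * X * P⁻¹) * P = P⁻¹ * P * X * (P⁻¹ * P) by simp only [Matrix.mul_assoc],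
    Matrix.nonsing_inv_mul _ hP, Matrix.one_mul, Matrix.mul_one]

/-- `P (P⁻¹ X P) P⁻¹ = X`. [folklore] -/
private theorem mul_inv_conj_inv₅₅ (hP : IsUnit P.det) (X : Matrix ι ι ℂ) : P * (P⁻¹ * X * P) * P⁻¹ = X := by
  rw [show P * (P⁻¹ * X * P) * P⁻¹ = P * P⁻¹ * X * (P * P⁻¹) by simp only [Matrix.mul_assoc],
    Matrix.mul_nonsing_inv _ hP, Matrix.one_mul, Matrix.mul_one]

/-- Conjugates of diagonal matrices multiply diagonally. [folklore] -/
private theorem conjDiag_mul₅₅ (hP : IsUnit P.det) (c c' : ι → ℂ) :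
    P * diagonal c * P⁻¹ * (P * diagonal c' * P⁻¹) = P * diagonal (c * c') * P⁻¹ := by
  rw [show P * diagonal c * P⁻¹ * (P * diagonal c' * P⁻¹) = P * diagonal c * (P⁻¹ * P) * diagonal c' * P⁻¹ by
    simp only [Matrix.mul_assoc], Matrix.nonsing_inv_mul _ hP, Matrix.mul_one, Matrix.mul_assoc P (diagonal c),
    diagonal_mul_diagonal]
  rfl

/-- The frame coordinates are unique: `P diag(c) P⁻¹ = P diag(c') P⁻¹ ⟹ c = c'`. [folklore] -/
private theorem conjDiag_injective₅₅ (hP : IsUnit P.det) {c c' : ι → ℂ}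
    (h : P * diagonal c * P⁻¹ = P * diagonal c' * P⁻¹) : c = c' := by
  have h' := congrArg (fun X ↦ P⁻¹ * X * P) h
  simp only [inv_mul_conj_mul₅₅ hP] at h'
  exact diagonal_injective h'

end Plumbing

/-! ### §1 The eigenframe of a simple CM threefold -/

section Eigenframe

variable {κ : Type} [Fintype κ] [DecidableEq κ] {E : Type} [NormedAddCommGroup E] [NormedSpace ℂ E]
  [FiniteDimensional ℂ E] {Ψ : (κ → ℝ) ≃L[ℝ] E} {η : E [⋀^Fin 2]→L[ℝ] ℝ}

omit [Fintype κ] [DecidableEq κ] in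
/-- `A ⊗ 1` with `algebraMap` is `A ⊗ 1` with the cast. [folklore] -/
private theorem map_algebraMap_eq_map_ratCast₅₅ (A : Matrix κ κ ℚ) : A.map (algebraMap ℚ ℂ) = A.map ((↑) : ℚ → ℂ) := by
  ext i j
  simp [Matrix.map_apply]

omit [Fintype κ] [DecidableEq κ] in
/-- `(A ⊗_ℚ ℝ) ⊗_ℝ ℂ = A ⊗_ℚ ℂ`. [folklore] -/
private theorem map_ratCast_map_ofRealHom₅₅ (A : Matrix κ κ ℚ) :
    (A.map ((↑) : ℚ → ℝ)).map Complex.ofRealHom = A.map (algebraMap ℚ ℂ) := by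
  ext i j
  simp [Matrix.map_apply]

/-- `exp(π i) ≠ 1`: the one-parameter group `t ↦ e^{tw}` is trivial only for `w = 0`. [folklore] -/
private theorem eq_zero_of_forall_exp_mul_eq_one₅₅ {w : ℂ} (h : ∀ t : ℂ, Complex.exp (t * w) = 1) : w = 0 := by
  by_contra hw
  have h1 := h (Real.pi * Complex.I / w)
  rw [div_mul_cancel₀ _ hw, Complex.exp_pi_mul_I] at h1
  norm_num at h1

/-- **THE EIGENFRAME OF A SIMPLE COMPLEX ABELIAN THREEFOLD WITH COMPLEX MULTIPLICATION.**  Let `T = E ∕ Ψ(ℤ^κ)` be a simple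
polarised abelian threefold with `[Z(End⁰ T) : ℚ] = 6` (Type IV(3,1), CM type).  There are a fixed-point-free involution `π` of
`κ` (`#κ = 6`), a frame `P ∈ GL_κ(ℂ)` (a common eigenbasis of `End⁰(T) ⊗ ℂ`) and a sign vector `s : κ → {±1}` such that:
(a) `Hg(T)(ℂ) = P · 𝕋_π · P⁻¹` («`Hg(X) = U_F`»); (b) `P diag(z) P⁻¹ ∈ Lie Hg(T)(ℂ) ⟺ z_{π j} = -z_j` for all `j`; (c) every element
of `Lie Hg(T)(ℂ)` is of the form `P diag(z) P⁻¹`; (d) `J ⊗ 1 = P diag(i s) P⁻¹` with `s ∘ π = -s`; (e) every `σ ∈ Aut(ℂ)` acts on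
`P diag(z) P⁻¹` through a permutation `g_σ` of the eigenlines commuting with `π` (`σ(P diag(z) P⁻¹) = P diag(σ ∘ z ∘ g_σ) P⁻¹`);
(f') for all lines `j, j'` SOME `σ` acts through a permutation with `g_σ j = j'` (`Aut(ℂ)` is transitive on the complex embeddings
of the field `F = End⁰(T)`).
[cite: MoonenZarhin1999LowDim, §2 (2.3) `g = 3` Type IV(3,1) (p0005 L104–L106: «`X` is of CM-type. We have `Hg(X) = U_F`»), §5 (5.10) (p0010 L24–L45)]
[cite: Shimura1998, §5.1 Prop. 5–6 and Lemma 2] [cite: Borel1991, §8.11] -/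
theorem IsSimple.exists_cmEigenframe_of_finrank_centerField_eq_six_of_finrank_eq_three [Nonempty κ] (hX : IsSimple Ψ)
    (hη : IsRiemannForm Ψ η) (h3 : finrank ℂ E = 3) (he : finrank ℚ (centerField Ψ hX) = 6) :
    ∃ (π : κ → κ) (hπ : Involutive π) (hπ' : ∀ j, π j ≠ j) (P : Matrix κ κ ℂ) (hP : IsUnit P.det) (s : κ → ℂ),
      Fintype.card κ = 6 ∧
      hodgeGroupC Ψ = (pairedDiagTorus hπ hπ').map (conjGLC P hP).toMonoidHom ∧
      (∀ z : κ → ℂ, P * diagonal z * P⁻¹ ∈ lieAlgebraGL ((hodgeGroupC Ψ).map Matrix.SpecialLinearGroup.toGL) ↔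
        ∀ j, z (π j) = -z j) ∧
      (∀ Z ∈ lieAlgebraGL ((hodgeGroupC Ψ).map Matrix.SpecialLinearGroup.toGL), ∃ z : κ → ℂ, Z = P * diagonal z * P⁻¹) ∧
      (∀ j, s j = 1 ∨ s j = -1) ∧ (∀ j, s (π j) = -s j) ∧
      (jMatrix Ψ).map Complex.ofRealHom = P * diagonal (fun j ↦ Complex.I * s j) * P⁻¹ ∧
      (∀ σ : ℂ ≃+* ℂ, ∃ g : Equiv.Perm κ, (∀ j, g (π j) = π (g j)) ∧
        ∀ z : κ → ℂ, (P * diagonal z * P⁻¹).map σ = P * diagonal (fun j ↦ σ (z (g j))) * P⁻¹) ∧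
      ∀ j j' : κ, ∃ (σ : ℂ ≃+* ℂ) (g : Equiv.Perm κ),
        (∀ z : κ → ℂ, (P * diagonal z * P⁻¹).map σ = P * diagonal (fun k ↦ σ (z (g k))) * P⁻¹) ∧
        (∀ k, g (π k) = π (g k)) ∧ g j = j' := by
  classical
  have hcard : Fintype.card κ = 6 := by rw [card_eq_two_mul_finrank Ψ, h3]
  haveI : IsReduced (endAlgRat Ψ) := by letI := hX.divisionRing; infer_instance
  obtain ⟨G, hG⟩ := hη.exists_ratMatrix_latticeGram
  have hcomm : ∀ a ∈ endAlgRat Ψ, ∀ b ∈ endAlgRat Ψ, a * b = b * a := hX.endAlgRat_comm_of_finrank_eq_three h3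
  have hdim : finrank ℚ (endAlgRat Ψ) = Fintype.card κ := by
    rw [← finrank_centerField_eq_of_comm hX fun a b ↦ Subtype.ext (hcomm a.1 a.2 b.1 b.2), he, hcard]
  have hGu : IsUnit G.det := isUnit_det_of_map_ratCast hG hη.isUnit_det_latticeGram
  have hGt : Gᵀ = -G := transpose_eq_neg_of_map_ratCast Ψ hG
  have hEnd : ∀ A ∈ endAlgRat Ψ, rosati G A ∈ endAlgRat Ψ := fun A hA ↦ rosati_mem_endAlgRat Ψ hη.1 hη.2.2 hG hA
  obtain ⟨π, hπ, hπ', P, hP, hT, hS⟩ := exists_lefschetzGroupC_eq_map_pairedDiagTorus Ψ hcomm hdim hGt hGu hEnd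
  have hHgS : hodgeGroupC Ψ = lefschetzGroupC Ψ G := hη.hodgeGroupC_eq_lefschetzGroupC_of_finrank_eq_three hG h3
  have hHg : hodgeGroupC Ψ = (pairedDiagTorus hπ hπ').map (conjGLC P hP).toMonoidHom := by rw [hHgS, hS]
  -- the algebra `𝒯 = End⁰(Y) ⊗ ℂ = {P diag(c) P⁻¹}`
  set 𝒯 := Submodule.span ℂ ((fun B : Matrix κ κ ℚ ↦ B.map (algebraMap ℚ ℂ)) '' (endAlgRat Ψ : Set (Matrix κ κ ℚ)))
    with h𝒯
  have hspan : ∀ c : κ → ℂ, P * diagonal c * P⁻¹ ∈ 𝒯 := conj_diagonal_mem_span_of_forall (endAlgRat Ψ) hcomm hdim hP hT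
  have hform : ∀ X ∈ 𝒯, ∃ c : κ → ℂ, X = P * diagonal c * P⁻¹ := fun X hX ↦
    exists_eq_conj_diagonal_of_mem_span (endAlgRat Ψ) hP hT hX
  have halg := isAlgebraicSubgroup_map_toGL_hodgeGroupC Ψ
  -- membership of group elements `P diag(d) P⁻¹`
  have hmemHg : ∀ {M : SpecialLinearGroup κ ℂ}, M ∈ hodgeGroupC Ψ ↔
      ∃ d : κ → ℂ, (∀ j, d (π j) * d j = 1) ∧ (M : Matrix κ κ ℂ) = P * diagonal d * P⁻¹ := by
    intro M
    rw [hHg, Subgroup.mem_map_equiv, mem_pairedDiagTorus_iff, coe_conjGLC_symm]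
    constructor
    · rintro ⟨d, hd, hM⟩
      exact ⟨d, hd, by rw [← mul_inv_conj_inv₅₅ hP (M : Matrix κ κ ℂ), hM]⟩
    · rintro ⟨d, hd, hM⟩
      exact ⟨d, hd, by rw [hM, inv_mul_conj_mul₅₅ hP]⟩
  -- (c) every element of `Lie Hg(Y)(ℂ)` lies in `𝒯`
  have hLieform : ∀ Z ∈ lieAlgebraGL ((hodgeGroupC Ψ).map Matrix.SpecialLinearGroup.toGL),
      ∃ z : κ → ℂ, Z = P * diagonal z * P⁻¹ := fun Z hZ ↦ by
    have hZ' : Z ∈ hodgeGroupLieC Ψ := (mem_hodgeGroupLieC_iff_mem_lieAlgebraGL Ψ).2 hZ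
    refine hform Z (mem_span_of_forall_map_mul_comm (endAlgRat Ψ) hcomm hdim fun t ht ↦ ?_)
    rw [map_algebraMap_eq_map_ratCast₅₅]
    exact map_ratCast_comm_of_mem_endAlgRat_of_mem_hodgeGroupLieC ht hZ'
  -- `exp` of a conjugated diagonal
  have hPu : IsUnit P := (Matrix.isUnit_iff_isUnit_det P).2 hP
  have hexp : ∀ (t : ℂ) (z : κ → ℂ), NormedSpace.exp (t • (P * diagonal z * P⁻¹)) =
      P * diagonal (fun j ↦ Complex.exp (t * z j)) * P⁻¹ := fun t z ↦ by
    rw [← exp_smul_diagonal, ← Matrix.exp_conj P (t • diagonal z) hPu, Matrix.mul_smul, Matrix.smul_mul]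
  -- (b) `P diag(z) P⁻¹ ∈ Lie Hg(Y)(ℂ) ⟺ z ∘ π = -z`
  have hLie : ∀ z : κ → ℂ, P * diagonal z * P⁻¹ ∈ lieAlgebraGL ((hodgeGroupC Ψ).map Matrix.SpecialLinearGroup.toGL) ↔
      ∀ j, z (π j) = -z j := by
    intro z
    constructor
    · intro hz j
      rw [eq_neg_iff_add_eq_zero]
      apply eq_zero_of_forall_exp_mul_eq_one₅₅
      intro t
      obtain ⟨g, hg, hgt⟩ := exists_mem_coe_eq_exp_smul_of_mem_lieAlgebraGL halg hz t
      obtain ⟨M, hM, rfl⟩ := Subgroup.mem_map.1 hg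
      obtain ⟨d, hd, hMd⟩ := hmemHg.1 hM
      rw [Matrix.SpecialLinearGroup.coe_GL_coe_matrix, hMd, hexp] at hgt
      have hdz : ∀ k, d k = Complex.exp (t * z k) := fun k ↦ congrFun (conjDiag_injective₅₅ hP hgt) k
      have h := hd j
      rw [hdz, hdz, ← Complex.exp_add, ← mul_add] at h
      exact h
    · intro hz
      refine mem_lieAlgebraGL_of_forall_exp_smul_mem halg fun t ↦ ?_
      have hd : ∀ j, Complex.exp (t * z (π j)) * Complex.exp (t * z j) = 1 := fun j ↦ by
        rw [← Complex.exp_add, hz j, mul_neg, neg_add_cancel, Complex.exp_zero]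
      refine ⟨Matrix.SpecialLinearGroup.toGL (conjGLC P hP (pairedDiag hπ hπ' (fun j ↦ Complex.exp (t * z j)) hd)),
        Subgroup.mem_map_of_mem _ ?_, ?_⟩
      · rw [hHg]
        exact Subgroup.mem_map_of_mem _ (pairedDiag_mem hπ hπ' (fun j ↦ Complex.exp (t * z j)) hd)
      · rw [Matrix.SpecialLinearGroup.coe_GL_coe_matrix, coe_conjGLC, coe_pairedDiag, hexp]
  -- (d) `J ⊗ 1 = P diag(c) P⁻¹` with `c = i s`, `s = ±1`, `s ∘ π = -s`
  have hJmem : (jMatrix Ψ).map Complex.ofRealHom ∈ 𝒯 := by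
    refine mem_span_of_forall_map_mul_comm (endAlgRat Ψ) hcomm hdim fun t ht ↦ ?_
    have h := (mem_endAlgRat_iff Ψ t).1 ht
    have h' := congrArg (fun X : Matrix κ κ ℝ ↦ X.map Complex.ofRealHom) h
    simp only [Matrix.map_mul, map_ratCast_map_ofRealHom₅₅] at h'
    exact h'
  obtain ⟨c, hJc⟩ := hform _ hJmem
  have hJLie : (jMatrix Ψ).map Complex.ofRealHom ∈ lieAlgebraGL ((hodgeGroupC Ψ).map Matrix.SpecialLinearGroup.toGL) :=
    (mem_hodgeGroupLieC_iff_mem_lieAlgebraGL Ψ).1 (jMatrix_map_mem_hodgeGroupLieC Ψ)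
  have hcπ : ∀ j, c (π j) = -c j := (hLie c).1 (hJc ▸ hJLie)
  have hc2 : ∀ j, c j * c j = -1 := fun j ↦ by
    have h : (jMatrix Ψ).map Complex.ofRealHom * (jMatrix Ψ).map Complex.ofRealHom = -1 :=
      map_ofRealHom_mul_self_of_mul_self (jMatrix_mul_jMatrix Ψ)
    rw [hJc, conjDiag_mul₅₅ hP] at h
    have h1 : diagonal (c * c) = -1 := by
      rw [← inv_mul_conj_mul₅₅ hP (diagonal (c * c)), h, Matrix.mul_neg, Matrix.mul_one, Matrix.neg_mul,
        Matrix.nonsing_inv_mul _ hP]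
    have h2 := congrFun (congrFun h1 j) j
    rw [diagonal_apply_eq, Matrix.neg_apply, Matrix.one_apply_eq] at h2
    exact h2
  obtain ⟨s, hs⟩ : ∃ s : κ → ℂ, ∀ j, s j = -Complex.I * c j := ⟨_, fun _ ↦ rfl⟩
  have hsc : ∀ j, c j = Complex.I * s j := fun j ↦ by
    rw [hs]
    linear_combination (c j) * Complex.I_sq
  have hs1 : ∀ j, s j = 1 ∨ s j = -1 := fun j ↦ by
    have h : (s j - 1) * (s j + 1) = 0 := by
      have h2 := hc2 j
      rw [hsc] at h2
      linear_combination (-1 : ℂ) * h2 + (s j) ^ 2 * Complex.I_sq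
    rcases mul_eq_zero.1 h with h | h
    · exact Or.inl (sub_eq_zero.1 h)
    · exact Or.inr (eq_neg_of_add_eq_zero_left h)
  have hsπ : ∀ j, s (π j) = -s j := fun j ↦ by
    rw [hs, hs, hcπ]
    ring
  -- (e) every `σ` permutes the eigenlines, compatibly with `π`
  have hAut : ∀ (σ : ℂ ≃+* ℂ) {Z : Matrix κ κ ℂ}, Z ∈ lieAlgebraGL ((hodgeGroupC Ψ).map Matrix.SpecialLinearGroup.toGL) →
      Z.map σ ∈ lieAlgebraGL ((hodgeGroupC Ψ).map Matrix.SpecialLinearGroup.toGL) := fun σ Z hZ ↦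
    map_mem_lieAlgebraGL_of_forall_map_mem (isAutStableGL_map_toGL_hodgeGroupC Ψ).map_mem σ hZ
  have hperm : ∀ σ : ℂ ≃+* ℂ, ∃ g : Equiv.Perm κ, (∀ j, g (π j) = π (g j)) ∧
      ∀ z : κ → ℂ, (P * diagonal z * P⁻¹).map σ = P * diagonal (fun j ↦ σ (z (g j))) * P⁻¹ := by
    intro σ
    obtain ⟨g, hg⟩ := exists_perm_forall_map_conj_diagonal hP σ fun c ↦
      hform _ (map_ringEquiv_mem_span₅₅ σ _ (hspan c))
    refine ⟨g, fun j' ↦ ?_, hg⟩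
    -- the antisymmetric vector `z = e_{g j'} - e_{π g j'}` is carried to the antisymmetric vector `z ∘ g`
    obtain ⟨z, hz⟩ : ∃ z : κ → ℂ, ∀ k, z k = if k = g j' then 1 else if k = π (g j') then -1 else 0 :=
      ⟨_, fun _ ↦ rfl⟩
    have hzπ : ∀ k, z (π k) = -z k := fun k ↦ by
      by_cases h1 : k = g j'
      · rw [h1]
        simp [hz, hπ' (g j')]
      · by_cases h2 : k = π (g j')
        · rw [h2, hπ (g j')]
          simp [hz, hπ' (g j')]
        · have h3 : π k ≠ g j' := fun h ↦ h2 (by rw [← h, hπ k])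
          have h4 : π k ≠ π (g j') := fun h ↦ h1 (hπ.injective h)
          simp [hz, h1, h2, h3, h4]
    have hzσ : ∀ k, σ (z k) = z k := fun k ↦ by
      rw [hz]
      split_ifs <;> simp
    have hmem := hAut σ ((hLie z).2 hzπ)
    rw [hg] at hmem
    simp only [hzσ] at hmem
    have h : z (g (π j')) = -z (g j') := (hLie _).1 hmem j'
    have hgj : z (g j') = 1 := by simp [hz]
    rw [hgj] at h
    by_contra hne
    have hne' : g (π j') ≠ g j' := fun h' ↦ hπ' j' (g.injective h')
    rw [hz, if_neg hne', if_neg hne] at h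
    norm_num at h
  -- (f) the characters `χ_j : F → ℂ` of the centre field `F = End⁰(Y)` (`A ⊗ 1 = P diag(χ_•(A)) P⁻¹`)
  choose cw hcw using fun w : centerField Ψ hX ↦ hT (centerField.val Ψ hX w) (centerField.val_mem Ψ hX w)
  have cw_mul : ∀ w w', cw (w * w') = cw w * cw w' := fun w w' ↦ by
    apply conjDiag_injective₅₅ hP
    rw [← hcw, map_mul, Matrix.map_mul, hcw, hcw, conjDiag_mul₅₅ hP]
  have cw_add : ∀ w w', cw (w + w') = cw w + cw w' := fun w w' ↦ by
    apply conjDiag_injective₅₅ hP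
    rw [← hcw, map_add, Matrix.map_add _ (map_add _), hcw, hcw,
      show diagonal (cw w + cw w') = diagonal (cw w) + diagonal (cw w') from (diagonal_add _ _).symm, Matrix.mul_add,
      Matrix.add_mul]
  have cw_one : cw 1 = 1 := by
    apply conjDiag_injective₅₅ hP
    rw [← hcw, map_one, Matrix.map_one _ (map_zero _) (map_one _), diagonal_one', Matrix.mul_one,
      Matrix.mul_nonsing_inv _ hP]
  have cw_zero : cw 0 = 0 := by
    have h := cw_add 0 0
    rw [add_zero, left_eq_add] at h
    exact h
  obtain ⟨χ, hχ⟩ : ∃ χ : κ → (centerField Ψ hX →+* ℂ), ∀ j w, χ j w = cw w j :=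
    ⟨fun j ↦
      { toFun := fun w ↦ cw w j
        map_one' := by rw [cw_one, Pi.one_apply]
        map_mul' := fun w w' ↦ by rw [cw_mul, Pi.mul_apply]
        map_zero' := by rw [cw_zero, Pi.zero_apply]
        map_add' := fun w w' ↦ by rw [cw_add, Pi.add_apply] }, fun _ _ ↦ rfl⟩
  -- every `A ∈ End⁰(Y)` is central (`End⁰(Y)` is commutative), so `A = val w`
  have hval : ∀ A ∈ endAlgRat Ψ, ∃ w : centerField Ψ hX, centerField.val Ψ hX w = A := fun A hA ↦
    centerField.exists_val_eq Ψ hX hA fun B hB ↦ hcomm A hA B hB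
  -- `χ` is injective: `(P⁻¹ X P)_{jj} = (P⁻¹ X P)_{kk}` on `𝒯 ∋ P E_{jj} P⁻¹` is absurd for `j ≠ k`
  have hχinj : Injective χ := fun j k hjk ↦ by
    by_contra hne
    have hjk' : ∀ w, cw w j = cw w k := fun w ↦ by rw [← hχ, ← hχ, hjk]
    have hlin : ∀ X ∈ 𝒯, (P⁻¹ * X * P) j j = (P⁻¹ * X * P) k k := by
      intro X hX𝒯
      induction hX𝒯 using Submodule.span_induction with
      | mem Y hY =>
        obtain ⟨A, hA, rfl⟩ := hY
        obtain ⟨w, hw⟩ := hval A hA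
        dsimp only
        rw [← hw, hcw, inv_mul_conj_mul₅₅ hP, diagonal_apply_eq, diagonal_apply_eq, hjk']
      | zero => simp
      | add Y Y' _ _ hY hY' => simp only [Matrix.mul_add, Matrix.add_mul, Matrix.add_apply, hY, hY']
      | smul a Y _ hY => simp only [Matrix.mul_smul, Matrix.smul_mul, Matrix.smul_apply, hY]
    have h := hlin _ (hspan (Pi.single j 1))
    rw [inv_mul_conj_mul₅₅ hP, diagonal_apply_eq, diagonal_apply_eq, Pi.single_eq_same, Pi.single_eq_of_ne' hne] at h
    exact one_ne_zero h
  -- every `σ ∈ Aut(ℂ)` permutes the characters: `σ ∘ χ_{g j} = χ_j` for the line permutation `g = g_σ` of (e)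
  have hgχ : ∀ (σ : ℂ ≃+* ℂ) (g : Equiv.Perm κ),
      (∀ z : κ → ℂ, (P * diagonal z * P⁻¹).map σ = P * diagonal (fun j ↦ σ (z (g j))) * P⁻¹) →
      ∀ j x, σ (χ (g j) x) = χ j x := fun σ g hg j x ↦ by
    have h := hg (cw x)
    rw [← hcw, map_algebraMap_map_ringEquiv₅₅, hcw] at h
    rw [hχ, hχ]
    exact (congrFun (conjDiag_injective₅₅ hP h) j).symm
  have hpermχ : ∀ σ : ℂ ≃+* ℂ, ∃ g : Equiv.Perm κ, ∀ j x, σ (χ (g j) x) = χ j x := fun σ ↦ by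
    obtain ⟨g, -, hg⟩ := hperm σ
    exact ⟨g, hgχ σ g hg⟩
  -- (f') TRANSITIVITY: `Aut(ℂ)` is transitive on the six characters `χ_j` of the field `F`, hence on the lines
  have hℂ : ℵ₀ < #ℂ := by
    rw [Cardinal.mk_complex]
    exact Cardinal.aleph0_lt_continuum
  haveI : Countable (centerField Ψ hX) := Finsupp.Countable.of_moduleFinite (R := ℚ) (M := centerField Ψ hX)
  have hF : #(centerField Ψ hX) ≤ ℵ₀ := Cardinal.mk_le_aleph0_iff.2 inferInstance
  have htrans : ∀ j j' : κ, ∃ (σ : ℂ ≃+* ℂ) (g : Equiv.Perm κ),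
      (∀ z : κ → ℂ, (P * diagonal z * P⁻¹).map σ = P * diagonal (fun k ↦ σ (z (g k))) * P⁻¹) ∧
      (∀ k, g (π k) = π (g k)) ∧ g j = j' := fun j j' ↦ by
    obtain ⟨σ, hσ⟩ := exists_ringEquiv_apply_eq hℂ hF (χ j') (χ j)
    obtain ⟨g, hgπ, hg⟩ := hperm σ
    refine ⟨σ, g, hg, hgπ, hχinj (RingHom.ext fun x ↦ σ.injective ?_)⟩
    rw [hgχ σ g hg j x, hσ x]
  have hJ : (jMatrix Ψ).map Complex.ofRealHom = P * diagonal (fun j ↦ Complex.I * s j) * P⁻¹ := by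
    rw [hJc, show c = fun j ↦ Complex.I * s j from funext hsc]
  exact ⟨π, hπ, hπ', P, hP, s, hcard, hHg, hLie, hLieform, hs1, hsπ, hJ, hperm, htrans⟩

end Eigenframe

end ComplexTorus

end Literature.Geometry.Kaehler
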